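import Literature.Analysis.ODE.GalerkinProjectionLp
import Mathlib.Analysis.PSeries
import HarnessLib

/-!
# Compact sets in `ℓᵖ` sequence spaces: uniform tails (condition S2 for self-consistent bounds)

Topic `Literature/Analysis/ODE`, continuing `GalerkinProjectionLp.lean`.  The abstract
`C⁰`-convergence theorem for Galerkin projections
(`Literature.Analysis.ODE.GalerkinConvergenceSetting.exists_limit`, [WilczakZgliczynski2025,
§4 Thm. 11]; file `GalerkinLimit.lean`) asks for a COMPACT, Galerkin-invariant set `W` of
self-consistent bounds (condition S = S1 + S2 of [WilczakZgliczynski2025, §4 Def. 4]).  On the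
sequence spaces `ℓᵖ`, `1 ≤ p < ∞` (good sequence spaces, loc. cit. §2), compactness is decided by
[WilczakZgliczynski2025, §2 Lemma 2]:

> `W ⊂ H` is compact iff it is closed, bounded and has uniform bounds on the tail, i.e. for every
> `ε > 0` there exists `N` such that `‖(I - P_n) w‖ < ε` for all `n ≥ N` and all `w ∈ W`,

and the sets of self-consistent bounds used in practice — coordinate boxes with polynomially or
geometrically decaying radii — are compact by [WilczakZgliczynski2025, §7.5 Thm. 26].  This file
proves these statements for Mathlib's `lp E p` (index type `α`, fibres `E i` real normed spaces;
for a Fourier–Galerkin scheme `α = ℕ` and `E i = ℝ` or `ℝ²`), with the coordinate projections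
`lpProj E p s` (`s : Finset α`) of `GalerkinProjectionLp.lean` in the role of `P_n`:

* `isCompact_of_uniform_tail` — Lemma 2, direction `⇐` (the one used to verify S2), for every
  `1 ≤ p ≤ ∞` and complete fibres: a closed set whose coordinates range in compact sets and whose
  tails `‖f - P_s f‖` are uniformly small for some finite `s` is compact (proof as printed:
  completeness + total boundedness, the latter from finitely many coordinates up to the tail);
* `exists_forall_norm_sub_lpProj_lt_of_isCompact` — Lemma 2, direction `⇒` (`p < ∞`): on a
  compact set the tails are uniformly small beyond some finite set of modes (the open cover
  `U_n = {‖(I - P_n) w‖ < ε}` of the printed proof); `isCompact_iff_uniform_tail` — Lemma 2 as an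
  equivalence (`p < ∞`, proper fibres);
* `tendsto_iff_forall_tendsto_apply_of_isCompact` — [WilczakZgliczynski2025, §2 Lemma 3]: inside
  a compact set a sequence converges iff it converges coordinatewise;
* `norm_sub_lpProj_le_of_norm_apply_le` and `isCompact_coordBox_of_summable` — Thm. 26 in the form
  in which it is applied: a coordinate box `{f | ∀ i, f i ∈ B i}` with compact factors dominated by
  radii `r i`, `Σ_i (r i)^p < ∞`, has tails `≤ (Σ_{i ∉ s} (r i)^p)^{1/p}` and is compact in `ℓᵖ`,
  `1 ≤ p < ∞`; the two families of the paper on one space dimension (modes indexed by `ℕ`),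
  `isCompact_polynomialBox` (`W_P(C,s) = {‖x_0‖ ≤ C, ‖x_k‖ ≤ C / k^s}`, compact in `ℓᵖ` for
  `s p > 1` — Thm. 26, second item with `d = 1`, `m = 0`) and `isCompact_geometricBox`
  (`W_exp(q,S) = {‖x_k‖ ≤ S / q^k}`, `q > 1`, compact in every `ℓᵖ` — Thm. 26, third item).
  Closed subsets inherit compactness (`IsCompact.of_isClosed_subset`), which is
  [WilczakZgliczynski2025, §7.5 Remark 25].

Together with `GalerkinProjectionLp.lean` (`mapsTo_lpGalerkin_coordBox` = S1,
`GalerkinConvergenceSetting.of_lp`) this discharges condition S of the `C⁰`-convergence theorem on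
`ℓᵖ(ℕ; E)` for the self-consistent bounds of [WilczakZgliczynski2025, §7.5]; the remaining
hypotheses of `GalerkinConvergenceSetting.of_lp` are the problem-specific C1, C2 and the Galerkin
solutions with their a priori bounds.

## References

* [WilczakZgliczynski2025] D. Wilczak, P. Zgliczyński, *Self-consistent bounds method for
  dissipative PDEs*, arXiv:2502.09760: §2 Def. 1, Lemma 1, **Lemma 2**, **Lemma 3**; §4 Def. 4
  (S1, S2); §7.5 Remark 25, **Thm. 26**.
* Mathlib: `lp`, `lp.norm_single`, `lp.norm_le_of_tsum_le`, `Metric.totallyBounded_of_finite_discretization`,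
  `isCompact_iff_totallyBounded_isComplete`, `Real.summable_nat_rpow_inv`.
-/

open Set Filter Topology Metric Finset
open scoped NNReal ENNReal

namespace Literature.Analysis.ODE

noncomputable section

variable {α : Type*} {E : α → Type*} [∀ i, NormedAddCommGroup (E i)] [∀ i, NormedSpace ℝ (E i)]
  {p : ℝ≥0∞} [Fact (1 ≤ p)]

/-- `1 ≤ p` gives `0 < p`. [folklore] -/
private theorem p_pos : 0 < p := zero_lt_one.trans_le Fact.out

/-- `1 ≤ p < ∞` gives `0 < p.toReal`. [folklore] -/
private theorem toReal_pos_of_ne_top (hp : p ≠ ∞) : 0 < p.toReal :=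
  ENNReal.toReal_pos p_pos.ne' hp

variable [DecidableEq α]

/-! ## Elementary estimates for the coordinate projections -/

/-- `‖P_s f‖ ≤ Σ_{i ∈ s} ‖f i‖` (every `1 ≤ p ≤ ∞`). [cite: WilczakZgliczynski2025, §2 Def. 1 (2), projection P_J] -/
theorem norm_lpProj_le_sum_norm (s : Finset α) (f : lp E p) :
    ‖lpProj E p s f‖ ≤ ∑ i ∈ s, ‖f i‖ := by
  rw [lpProj_apply]
  refine (norm_sum_le _ _).trans (le_of_eq (Finset.sum_congr rfl fun i _ => ?_))
  exact lp.norm_single p_pos i (f i)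

/-- Coordinates of the tail `f - P_s f`: `0` on `s`, `f j` off `s`. [cite: WilczakZgliczynski2025, §2 (Q_n = Id - P_n)] -/
theorem sub_lpProj_coe_apply (s : Finset α) (f : lp E p) (j : α) :
    ((f - lpProj E p s f : lp E p) : ∀ i, E i) j = if j ∈ s then 0 else f j := by
  rw [lp.coeFn_sub, Pi.sub_apply, lpProj_coe_apply]
  split_ifs <;> simp

/-- The tails are monotone in the set of modes: `s ⊆ t → ‖f - P_t f‖ ≤ ‖f - P_s f‖` (the
inclusion `U_n ⊂ U_{n+M}` in the proof of Lemma 2). [cite: WilczakZgliczynski2025, §2 Lemma 2 (proof, U_n ⊂ U_{n+M})] -/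
theorem norm_sub_lpProj_anti {s t : Finset α} (hst : s ⊆ t) (f : lp E p) :
    ‖f - lpProj E p t f‖ ≤ ‖f - lpProj E p s f‖ := by
  refine lp.norm_mono p_pos.ne' fun j => ?_
  rw [sub_lpProj_coe_apply, sub_lpProj_coe_apply]
  by_cases ht : j ∈ t
  · rw [if_pos ht, norm_zero]
    exact norm_nonneg _
  · rw [if_neg ht, if_neg fun h => ht (hst h)]

/-- The distance of two elements is bounded by their two tails plus finitely many coordinate
distances: the splitting `‖d - d'‖ ≤ ‖P_n d - P_n d'‖ + ‖(I-P_n) d‖ + ‖(I-P_n) d'‖`. [cite: WilczakZgliczynski2025, §2 Lemma 2 (proof, three-term splitting)] -/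
theorem norm_sub_le_tail_add (s : Finset α) (f g : lp E p) :
    ‖f - g‖ ≤ ‖f - lpProj E p s f‖ + ∑ i ∈ s, ‖f i - g i‖ + ‖g - lpProj E p s g‖ := by
  have hsplit : f - g = (f - lpProj E p s f) + lpProj E p s (f - g) - (g - lpProj E p s g) := by
    rw [map_sub]; abel
  calc ‖f - g‖ = ‖(f - lpProj E p s f) + lpProj E p s (f - g) - (g - lpProj E p s g)‖ := by
        rw [← hsplit]
    _ ≤ ‖f - lpProj E p s f‖ + ‖lpProj E p s (f - g)‖ + ‖g - lpProj E p s g‖ :=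
        (norm_sub_le _ _).trans (add_le_add (norm_add_le _ _) le_rfl)
    _ ≤ ‖f - lpProj E p s f‖ + ∑ i ∈ s, ‖f i - g i‖ + ‖g - lpProj E p s g‖ := by
        gcongr
        refine (norm_lpProj_le_sum_norm s (f - g)).trans (le_of_eq ?_)
        exact Finset.sum_congr rfl fun i _ => by rw [lp.coeFn_sub, Pi.sub_apply]

omit [DecidableEq α] in
/-- Coordinate boxes with closed factors are closed in `ℓᵖ`. [cite: WilczakZgliczynski2025, §7.5 (proof of Thm. 26: "the sets W_P, W_exp are closed")] -/
theorem isClosed_coordBox {B : ∀ i, Set (E i)} (hB : ∀ i, IsClosed (B i)) :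
    IsClosed {f : lp E p | ∀ i, f i ∈ B i} := by
  have h : {f : lp E p | ∀ i, f i ∈ B i} = ⋂ i, (fun f : lp E p => lpEval E p i f) ⁻¹' B i := by
    ext f; simp
  rw [h]
  exact isClosed_iInter fun i => (hB i).preimage (lpEval E p i).continuous

/-! ## [WilczakZgliczynski2025, §2 Lemma 2]: compact iff closed, bounded, uniform tails -/

/-- **Lemma 2, `⇐`** (the direction that verifies condition S2), for every `1 ≤ p ≤ ∞` and
complete fibres: a closed `K ⊆ ℓᵖ` whose coordinates range in compact sets and whose tails are
uniformly small — for every `ε > 0` some finite set of modes `s` has `‖f - P_s f‖ < ε` for all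
`f ∈ K` — is compact.  (Printed proof: a diagonal subsequence converging in every coordinate is
Cauchy by the three-term splitting, and `H` is complete; here equivalently: `K` is complete and
totally bounded, finitely many coordinates determining an element up to `ε`.)
[cite: WilczakZgliczynski2025, §2 Lemma 2 (⇐)] -/
theorem isCompact_of_uniform_tail [∀ i, CompleteSpace (E i)] {K : Set (lp E p)}
    (hK : IsClosed K) (hcoord : ∀ i, ∃ C : Set (E i), IsCompact C ∧ ∀ f ∈ K, f i ∈ C)
    (htail : ∀ ε, 0 < ε → ∃ s : Finset α, ∀ f ∈ K, ‖f - lpProj E p s f‖ < ε) :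
    IsCompact K := by
  rw [isCompact_iff_totallyBounded_isComplete]
  refine ⟨Metric.totallyBounded_of_finite_discretization fun ε hε => ?_, hK.isComplete⟩
  obtain ⟨s, hs⟩ := htail (ε / 3) (by positivity)
  choose C hC hKC using hcoord
  obtain ⟨δ, hδpos, hδ⟩ : ∃ δ : ℝ, 0 < δ ∧ (s.card : ℝ) * (δ + δ) ≤ ε / 3 := by
    have h6 : (0 : ℝ) < 6 * ((s.card : ℝ) + 1) := by positivity
    have hXpos : 0 < ε / (6 * ((s.card : ℝ) + 1)) := by positivity
    have h1 : ε / (6 * ((s.card : ℝ) + 1)) * (6 * ((s.card : ℝ) + 1)) = ε :=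
      div_mul_cancel₀ _ h6.ne'
    exact ⟨_, hXpos, by nlinarith [(Nat.cast_nonneg _ : (0 : ℝ) ≤ s.card)]⟩
  -- finitely many coordinates, with values in a compact product
  let Φ : lp E p → (∀ i : s, E i) := fun f i => f i
  have hQ : IsCompact (Set.pi Set.univ fun i : s => C (i : α)) := isCompact_univ_pi fun i => hC i
  obtain ⟨t, -, htfin, hcover⟩ :=
    Metric.finite_approx_of_totallyBounded hQ.totallyBounded δ hδpos
  have hΦ : ∀ f : K, ∃ y ∈ t, dist (Φ f) y < δ := by
    intro f
    have hmem : Φ f ∈ Set.pi Set.univ fun i : s => C (i : α) :=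
      Set.mem_univ_pi.2 fun i => hKC i f f.2
    obtain ⟨y, hy, hyball⟩ := Set.mem_iUnion₂.1 (hcover hmem)
    exact ⟨y, hy, mem_ball.1 hyball⟩
  choose F hFt hFd using hΦ
  haveI : Fintype t := htfin.fintype
  refine ⟨t, inferInstance, fun f => ⟨F f, hFt f⟩, fun f g hfg => ?_⟩
  have hy : F f = F g := congrArg Subtype.val hfg
  -- the chosen net points agree, so the `s`-coordinates of `f` and `g` are `2δ`-close
  have h2 : dist (Φ f) (Φ g) < δ + δ := by
    calc dist (Φ f) (Φ g) ≤ dist (Φ f) (F f) + dist (Φ g) (F f) := dist_triangle_right _ _ _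
      _ < δ + δ := by
          refine add_lt_add (hFd f) ?_
          rw [hy]; exact hFd g
  have hcoord' : ∀ i ∈ s, ‖(f : lp E p) i - (g : lp E p) i‖ ≤ δ + δ := by
    intro i hi
    have h := dist_le_pi_dist (Φ f) (Φ g) ⟨i, hi⟩
    rw [dist_eq_norm] at h
    exact h.trans h2.le
  have hsum : ∑ i ∈ s, ‖(f : lp E p) i - (g : lp E p) i‖ ≤ s.card * (δ + δ) := by
    calc ∑ i ∈ s, ‖(f : lp E p) i - (g : lp E p) i‖ ≤ ∑ _i ∈ s, (δ + δ) :=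
          Finset.sum_le_sum hcoord'
      _ = s.card * (δ + δ) := by rw [Finset.sum_const, nsmul_eq_mul]
  have hf3 : ‖(f : lp E p) - lpProj E p s f‖ < ε / 3 := hs f f.2
  have hg3 : ‖(g : lp E p) - lpProj E p s g‖ < ε / 3 := hs g g.2
  have hm3 : ∑ i ∈ s, ‖(f : lp E p) i - (g : lp E p) i‖ ≤ ε / 3 := hsum.trans hδ
  have key : ‖(f : lp E p) - (g : lp E p)‖ < ε := by
    have h := norm_sub_le_tail_add s (f : lp E p) (g : lp E p)
    linarith
  rw [dist_eq_norm]
  exact key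

/-- **Lemma 2, `⇒`** (`1 ≤ p < ∞`): on a compact `K ⊆ ℓᵖ` the tails are uniformly small — for
every `ε > 0` there is a finite set of modes `s₀` with `‖f - P_s f‖ < ε` for all `s ⊇ s₀` and all
`f ∈ K` (printed proof: the increasing open cover `U_n = {‖(I - P_n) w‖ < ε}`).
[cite: WilczakZgliczynski2025, §2 Lemma 2 (⇒)] -/
theorem exists_forall_norm_sub_lpProj_lt_of_isCompact (hp : p ≠ ∞) {K : Set (lp E p)}
    (hK : IsCompact K) {ε : ℝ} (hε : 0 < ε) :
    ∃ s₀ : Finset α, ∀ s, s₀ ⊆ s → ∀ f ∈ K, ‖f - lpProj E p s f‖ < ε := by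
  let U : Finset α → Set (lp E p) := fun s => {f | ‖f - lpProj E p s f‖ < ε}
  have hopen : ∀ s, IsOpen (U s) := fun s =>
    isOpen_lt (continuous_id.sub (lpProj E p s).continuous).norm continuous_const
  have hcov : K ⊆ ⋃ s, U s := by
    intro f _
    have h1 : Tendsto (fun s : Finset α => ‖f - lpProj E p s f‖) atTop (𝓝 0) := by
      have h := (tendsto_iff_norm_sub_tendsto_zero.1 (tendsto_lpProj_atTop hp f))
      refine h.congr fun s => ?_
      rw [norm_sub_rev]
    obtain ⟨s, hs⟩ := ((tendsto_order.1 h1).2 ε hε).exists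
    exact Set.mem_iUnion.2 ⟨s, hs⟩
  obtain ⟨T, hT⟩ := hK.elim_finite_subcover U hopen hcov
  refine ⟨T.sup id, fun s hs f hf => ?_⟩
  obtain ⟨s', hs'T, hfs'⟩ := Set.mem_iUnion₂.1 (hT hf)
  have hsub : s' ⊆ s := (Finset.le_sup (f := id) hs'T).trans hs
  exact (norm_sub_lpProj_anti hsub f).trans_lt hfs'

/-- **Lemma 2** as an equivalence (`1 ≤ p < ∞`, fibres proper — e.g. finite-dimensional — so
that bounded coordinates range in compact sets): `K ⊆ ℓᵖ` is compact iff it is closed, bounded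
and has uniformly small tails. [cite: WilczakZgliczynski2025, §2 Lemma 2] -/
theorem isCompact_iff_uniform_tail [∀ i, ProperSpace (E i)] (hp : p ≠ ∞) {K : Set (lp E p)} :
    IsCompact K ↔ IsClosed K ∧ Bornology.IsBounded K ∧
      ∀ ε, 0 < ε → ∃ s : Finset α, ∀ f ∈ K, ‖f - lpProj E p s f‖ < ε := by
  refine ⟨fun hK => ⟨hK.isClosed, hK.isBounded, fun ε hε => ?_⟩, fun ⟨hcl, hbd, htail⟩ => ?_⟩
  · obtain ⟨s₀, hs₀⟩ := exists_forall_norm_sub_lpProj_lt_of_isCompact hp hK hε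
    exact ⟨s₀, hs₀ s₀ subset_rfl⟩
  · obtain ⟨R, hR⟩ := hbd.exists_norm_le
    refine isCompact_of_uniform_tail hcl (fun i => ⟨closedBall 0 R, isCompact_closedBall _ _,
      fun f hf => ?_⟩) htail
    rw [mem_closedBall_zero_iff]
    exact (lp.norm_apply_le_norm p_pos.ne' f i).trans (hR f hf)

/-! ## [WilczakZgliczynski2025, §2 Lemma 3]: convergence in a compact set is coordinatewise -/

omit [DecidableEq α] in
/-- **Lemma 3**: inside a compact `K ⊆ ℓᵖ` (any `1 ≤ p ≤ ∞`), a sequence converges to `c` iff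
it converges to `c` coordinatewise (then automatically `c ∈ K`). [cite: WilczakZgliczynski2025, §2 Lemma 3] -/
theorem tendsto_iff_forall_tendsto_apply_of_isCompact {K : Set (lp E p)} (hK : IsCompact K)
    {u : ℕ → lp E p} (hu : ∀ n, u n ∈ K) {c : lp E p} :
    Tendsto u atTop (𝓝 c) ↔ ∀ i, Tendsto (fun n => u n i) atTop (𝓝 (c i)) := by
  refine ⟨fun h i => ((lpEval E p i).continuous.tendsto c).comp h, fun h => ?_⟩
  refine tendsto_of_subseq_tendsto fun ns hns => ?_
  obtain ⟨a, -, φ, hφ, hlim⟩ := hK.tendsto_subseq fun n => hu (ns n)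
  have hac : a = c := by
    refine lp.ext (funext fun i => ?_)
    have h1 : Tendsto (fun n => (u ∘ ns ∘ φ) n i) atTop (𝓝 (a i)) :=
      ((lpEval E p i).continuous.tendsto a).comp hlim
    have h2 : Tendsto (fun n => (u ∘ ns ∘ φ) n i) atTop (𝓝 (c i)) :=
      (h i).comp (hns.comp hφ.tendsto_atTop)
    exact tendsto_nhds_unique h1 h2
  exact ⟨φ, hac ▸ hlim⟩

/-! ## [WilczakZgliczynski2025, §7.5 Thm. 26]: coordinate boxes with summable radii -/

/-- The tail of an element dominated off `s` by radii `r i` with `Σ (r i)^p < ∞` (`1 ≤ p < ∞`):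
`‖f - P_s f‖ ≤ (Σ_{i ∉ s} (r i)^p)^{1/p}` — the estimate `Σ_{|k| ≥ n} |x_k|^p ≲ ∫_n^∞ x(r)^p dr`
of the printed proof, before evaluating the sum. [cite: WilczakZgliczynski2025, §7.5 Thm. 26 (proof)] -/
theorem norm_sub_lpProj_le_of_norm_apply_le (hp : p ≠ ∞) {r : α → ℝ} (hr0 : ∀ i, 0 ≤ r i)
    (hr : Summable fun i => r i ^ p.toReal) (s : Finset α) {f : lp E p}
    (hf : ∀ i, i ∉ s → ‖f i‖ ≤ r i) :
    ‖f - lpProj E p s f‖ ≤ (∑' i : {i // i ∉ s}, r i ^ p.toReal) ^ (1 / p.toReal) := by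
  have hp' : 0 < p.toReal := toReal_pos_of_ne_top hp
  have htail0 : 0 ≤ ∑' i : {i // i ∉ s}, r i ^ p.toReal :=
    tsum_nonneg fun i => Real.rpow_nonneg (hr0 i) _
  refine lp.norm_le_of_tsum_le hp' (Real.rpow_nonneg htail0 _) ?_
  rw [one_div, Real.rpow_inv_rpow htail0 hp'.ne']
  -- coordinates of the tail: `0` on `s`, `f i` off `s`
  have hcoe : ∀ i, ‖((f - lpProj E p s f : lp E p) : ∀ i, E i) i‖ ^ p.toReal =
      Set.indicator ((↑s : Set α)ᶜ) (fun i => ‖f i‖ ^ p.toReal) i := by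
    intro i
    rw [sub_lpProj_coe_apply]
    by_cases hi : i ∈ s
    · rw [if_pos hi, norm_zero, Real.zero_rpow hp'.ne', Set.indicator_of_notMem]
      exact fun h => h (Finset.mem_coe.2 hi)
    · rw [if_neg hi, Set.indicator_of_mem]
      exact fun h => hi (Finset.mem_coe.1 h)
  have hind : ∀ i, Set.indicator ((↑s : Set α)ᶜ) (fun i => ‖f i‖ ^ p.toReal) i ≤
      Set.indicator ((↑s : Set α)ᶜ) (fun i => r i ^ p.toReal) i := by
    intro i
    by_cases hi : i ∈ ((↑s : Set α)ᶜ)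
    · rw [Set.indicator_of_mem hi, Set.indicator_of_mem hi]
      exact Real.rpow_le_rpow (norm_nonneg _) (hf i fun h => hi (Finset.mem_coe.2 h)) hp'.le
    · rw [Set.indicator_of_notMem hi, Set.indicator_of_notMem hi]
  calc ∑' i, ‖((f - lpProj E p s f : lp E p) : ∀ i, E i) i‖ ^ p.toReal
      = ∑' i, Set.indicator ((↑s : Set α)ᶜ) (fun i => ‖f i‖ ^ p.toReal) i := tsum_congr hcoe
    _ ≤ ∑' i, Set.indicator ((↑s : Set α)ᶜ) (fun i => r i ^ p.toReal) i :=
        Summable.tsum_le_tsum hind (((lp.memℓp f).summable hp').indicator _) (hr.indicator _)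
    _ = ∑' i : {i // i ∉ s}, r i ^ p.toReal :=
        (_root_.tsum_subtype ((↑s : Set α)ᶜ) fun i => r i ^ p.toReal).symm

/-- Uniform tails of a dominated box: for every `ε > 0` some finite set of modes `s` has
`‖f - P_s f‖ < ε` for every `f` with `‖f i‖ ≤ r i` (`i ∉ s`), when `Σ (r i)^p < ∞`, `1 ≤ p < ∞`.
[cite: WilczakZgliczynski2025, §7.5 Thm. 26 (proof: convergence of the tail sums)] -/
theorem exists_forall_norm_sub_lpProj_lt_of_summable (hp : p ≠ ∞) {r : α → ℝ}
    (hr0 : ∀ i, 0 ≤ r i) (hr : Summable fun i => r i ^ p.toReal) {ε : ℝ} (hε : 0 < ε) :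
    ∃ s : Finset α, ∀ f : lp E p, (∀ i, i ∉ s → ‖f i‖ ≤ r i) → ‖f - lpProj E p s f‖ < ε := by
  have hp' : 0 < p.toReal := toReal_pos_of_ne_top hp
  have htail : Tendsto (fun s : Finset α => ∑' i : {i // i ∉ s}, r i ^ p.toReal) atTop (𝓝 0) :=
    tendsto_tsum_compl_atTop_zero fun i => r i ^ p.toReal
  have hεp : 0 < ε ^ p.toReal := Real.rpow_pos_of_pos hε _
  obtain ⟨s, hs⟩ := ((tendsto_order.1 htail).2 _ hεp).exists
  refine ⟨s, fun f hf => (norm_sub_lpProj_le_of_norm_apply_le hp hr0 hr s hf).trans_lt ?_⟩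
  have htail0 : 0 ≤ ∑' i : {i // i ∉ s}, r i ^ p.toReal :=
    tsum_nonneg fun i => Real.rpow_nonneg (hr0 i) _
  calc (∑' i : {i // i ∉ s}, r i ^ p.toReal) ^ (1 / p.toReal)
      < (ε ^ p.toReal) ^ (1 / p.toReal) :=
        Real.rpow_lt_rpow htail0 hs (one_div_pos.2 hp')
    _ = ε := by rw [one_div, Real.rpow_rpow_inv hε.le hp'.ne']

/-- **Thm. 26 (abstract form): a coordinate box with compact factors and `p`-summable radii is
compact in `ℓᵖ`, `1 ≤ p < ∞`.**  If every `B i ⊆ E i` is compact and contained in the ball of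
radius `r i`, with `Σ_i (r i)^p < ∞`, then `{f ∈ ℓᵖ | ∀ i, f i ∈ B i}` is compact (closed by
`isClosed_coordBox`, uniform tails by `exists_forall_norm_sub_lpProj_lt_of_summable`, Lemma 2).
Closed subsets — e.g. smaller boxes — are then compact as well (Remark 25).
[cite: WilczakZgliczynski2025, §7.5 Thm. 26 and Remark 25; §2 Lemma 2] -/
theorem isCompact_coordBox_of_summable [∀ i, CompleteSpace (E i)] (hp : p ≠ ∞)
    {B : ∀ i, Set (E i)} (hB : ∀ i, IsCompact (B i)) {r : α → ℝ}
    (hr : Summable fun i => r i ^ p.toReal) (hBr : ∀ i, ∀ b ∈ B i, ‖b‖ ≤ r i) :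
    IsCompact {f : lp E p | ∀ i, f i ∈ B i} := by
  by_cases hne : ∀ i, (B i).Nonempty
  · have hr0 : ∀ i, 0 ≤ r i := fun i => by
      obtain ⟨b, hb⟩ := hne i
      exact (norm_nonneg b).trans (hBr i b hb)
    refine isCompact_of_uniform_tail (isClosed_coordBox fun i => (hB i).isClosed)
      (fun i => ⟨B i, hB i, fun f hf => hf i⟩) fun ε hε => ?_
    obtain ⟨s, hs⟩ := exists_forall_norm_sub_lpProj_lt_of_summable (E := E) hp hr0 hr hε
    exact ⟨s, fun f hf => hs f fun i _ => hBr i (f i) (hf i)⟩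
  · -- some factor is empty: the box is empty
    push Not at hne
    obtain ⟨i, hi⟩ := hne
    have hempty : {f : lp E p | ∀ i, f i ∈ B i} = ∅ := by
      ext f
      simp only [Set.mem_setOf_eq, Set.mem_empty_iff_false, iff_false, not_forall]
      exact ⟨i, by rw [hi]; exact Set.notMem_empty _⟩
    rw [hempty]
    exact isCompact_empty

end

/-! ## The two families of self-consistent bounds on one space dimension (modes `k ∈ ℕ`) -/

noncomputable section

variable {E : ℕ → Type*} [∀ i, NormedAddCommGroup (E i)] [∀ i, NormedSpace ℝ (E i)]
  {p : ℝ≥0∞} [Fact (1 ≤ p)]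

/-- `1 ≤ p < ∞` gives `0 < p.toReal` (copy for the `ℕ`-indexed section). [folklore] -/
private theorem toReal_pos_of_ne_top' (hp : p ≠ ∞) : 0 < p.toReal :=
  ENNReal.toReal_pos (zero_lt_one.trans_le (Fact.out : 1 ≤ p)).ne' hp

/-- **Thm. 26, polynomial decay, one space dimension**: the set
`W_P(C,s) = {x | ‖x_0‖ ≤ C, ‖x_k‖ ≤ C / k^s (k ≥ 1)}` is compact in `ℓᵖ(ℕ; E)` provided
`s · p > 1` (the condition `(s - m) p > d` with `d = 1`, `m = 0`), for proper (e.g.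
finite-dimensional) fibres. [cite: WilczakZgliczynski2025, §7.5 Thm. 26 (second item, d = 1, m = 0)] -/
theorem isCompact_polynomialBox [∀ i, ProperSpace (E i)] (hp : p ≠ ∞) {C s : ℝ} (hC : 0 ≤ C)
    (hs : 1 < s * p.toReal) :
    IsCompact {f : lp E p | ‖f 0‖ ≤ C ∧ ∀ k : ℕ, 1 ≤ k → ‖f k‖ ≤ C / (k : ℝ) ^ s} := by
  have hbox : {f : lp E p | ‖f 0‖ ≤ C ∧ ∀ k : ℕ, 1 ≤ k → ‖f k‖ ≤ C / (k : ℝ) ^ s} =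
      {f : lp E p | ∀ k, f k ∈ closedBall (0 : E k) (if k = 0 then C else C / (k : ℝ) ^ s)} := by
    ext f
    simp only [Set.mem_setOf_eq, mem_closedBall_zero_iff]
    constructor
    · rintro ⟨h0, hk⟩ k
      split_ifs with hk0
      · subst hk0; exact h0
      · exact hk k (Nat.one_le_iff_ne_zero.2 hk0)
    · intro h
      refine ⟨by simpa using h 0, fun k hk => ?_⟩
      simpa [Nat.one_le_iff_ne_zero.1 hk] using h k
  rw [hbox]
  refine isCompact_coordBox_of_summable hp (fun k => isCompact_closedBall _ _)
    (r := fun k => if k = 0 then C else C / (k : ℝ) ^ s) ?_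
    fun k b hb => mem_closedBall_zero_iff.1 hb
  -- summability of `(C / k^s)^p = C^p · (k^(s p))⁻¹`, `k ≥ 1` (a `p`-series with `s p > 1`)
  have hg : Summable fun k : ℕ => C ^ p.toReal * ((k : ℝ) ^ (s * p.toReal))⁻¹ :=
    (Real.summable_nat_rpow_inv.2 hs).mul_left _
  refine (summable_nat_add_iff 1).1 (((summable_nat_add_iff 1).2 hg).congr fun k => ?_)
  have hk : (0 : ℝ) ≤ ((k + 1 : ℕ) : ℝ) := Nat.cast_nonneg _
  have hne : k + 1 ≠ 0 := Nat.succ_ne_zero k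
  rw [if_neg hne, Real.div_rpow hC (Real.rpow_nonneg hk _), ← Real.rpow_mul hk, div_eq_mul_inv]

/-- **Thm. 26, geometric decay**: the set `W_exp(q,S) = {x | ‖x_k‖ ≤ S / q^k}`, `q > 1`, is
compact in `ℓᵖ(ℕ; E)` for every `1 ≤ p < ∞`, for proper fibres. [cite: WilczakZgliczynski2025, §7.5 Thm. 26 (third item)] -/
theorem isCompact_geometricBox [∀ i, ProperSpace (E i)] (hp : p ≠ ∞) {S q : ℝ} (hS : 0 ≤ S)
    (hq : 1 < q) :
    IsCompact {f : lp E p | ∀ k : ℕ, ‖f k‖ ≤ S / q ^ k} := by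
  have hp' : 0 < p.toReal := toReal_pos_of_ne_top' hp
  have hq0 : 0 < q := zero_lt_one.trans hq
  have hbox : {f : lp E p | ∀ k : ℕ, ‖f k‖ ≤ S / q ^ k} =
      {f : lp E p | ∀ k, f k ∈ closedBall (0 : E k) (S / q ^ k)} := by
    ext f; simp only [Set.mem_setOf_eq, mem_closedBall_zero_iff]
  rw [hbox]
  refine isCompact_coordBox_of_summable hp (fun k => isCompact_closedBall _ _)
    (r := fun k => S / q ^ k) ?_ fun k b hb => mem_closedBall_zero_iff.1 hb
  -- `(S / q^k)^p = S^p · ((q^p)⁻¹)^k`, a geometric series with ratio `(q^p)⁻¹ < 1`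
  have hratio : (q ^ p.toReal)⁻¹ < 1 := inv_lt_one_of_one_lt₀ (Real.one_lt_rpow hq hp')
  have hratio0 : 0 ≤ (q ^ p.toReal)⁻¹ := inv_nonneg.2 (Real.rpow_nonneg hq0.le _)
  refine ((summable_geometric_of_lt_one hratio0 hratio).mul_left (S ^ p.toReal)).congr
    fun k => ?_
  have hk : ((q ^ k) ^ p.toReal)⁻¹ = (q ^ p.toReal)⁻¹ ^ k := by
    rw [← Real.rpow_natCast q k, ← Real.rpow_mul hq0.le, mul_comm, Real.rpow_mul hq0.le,
      Real.rpow_natCast, inv_pow]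
  rw [Real.div_rpow hS (pow_nonneg hq0.le _), div_eq_mul_inv, hk]

end

end Literature.Analysis.ODE
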